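import Literature.Combinatorics.Enumerative.SporadicS18RatioProofs
import Mathlib.NumberTheory.Padics.PadicVal.Basic
import Mathlib.Tactic
import HarnessLib

/-!
# Osburn–Sahu–Straub 2016, Theorem 1.3 — II: the summand congruences `𝒟(np, kp) ≡ 𝒟(n, k)` and `𝒟(n, k) ≡ 0` (`p ∤ k`)

Topic `Literature/Combinatorics/Enumerative`, namespace `Literature.Combinatorics.Enumerative.SporadicS18Proofs`; the
sequel of `SporadicS18RatioProofs.lean` and the input of `SporadicS18Proofs.lean`. Everything here is PROVED (theorems
only; no definitions, no named facts). HONEST FRAMING (cell pub-zeta5, D2 lens): a classical supercongruence for a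
sporadic Apéry-like sequence; nothing about `ζ(5)`.

With the summand of (7), `𝒟(n,k) = (−1)^k C(n,k) C(2k,k) C(2(n−k),n−k) [C(2n−3k−1,n) + C(2n−3k,n)]` (written inline,
exactly as in `AperyGaussCongruences.s18`):

* `summand_eq_zero_of_lt` — `𝒟(n,k) = 0` for `n < 3k` (`n ≥ 1`);
* `pow_dvd_summand_of_not_dvd` — «for integers `k` such that `p ∤ k`, `𝒟(mp^r, k) ≡ 0 (mod p^{2r})` … an immediate
  consequence of the fact that `𝒟(n,k)` is divisible by `C(n,k)²`»: `p^{2 v_p(n)} ∣ 𝒟(n,k)`;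
* `pow_dvd_summand_mul_prime_sub` — the heart: `p^{2 v_p(n) + 2} ∣ 𝒟(np, kp) − 𝒟(n, k)` for `n ≥ 1`, `k ≤ n`, EVERY prime
  `p` (the printed `𝒟(mp^r, kp^s) ≡ 𝒟(mp^{r−1}, kp^{s−1}) (mod p^{3r})` for `p ≥ 5`, with the `p = 3` and `p = 2` paragraphs):
  the four unit ratios (41) for `C(n,k)`, `C(2k,k)`, `C(2(n−k),n−k)` and `C(2n−3k−1,n) + C(2n−3k,n)` (previous file), the
  bookkeeping of exponents in the three regimes `v_p(k) <, =, > v_p(n)` (at `p = 2` with the extra parity facts that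
  `n − k` and `n − 3k` are even when `n, k` are odd), and the cancellation of the five signs
  `(−1)^{kp−k} ε₁ε₂ε₃ε₄ = 1` at `p = 2`.

References: [OsburnSahuStraub2016] Theorem 1.3 and §2 (proof); [Straub2014] Lemma 5.1 (41).
-/

open Finset

namespace Literature.Combinatorics.Enumerative.SporadicS18Proofs

/-! ### §1. Vanishing and the free part -/

/-- `𝒟(n,k) = 0` when `n < 3k` (and `n ≥ 1`): both `C(2n−3k−1, n)` and `C(2n−3k, n)` vanish (natural-number subtraction
included). [cite: OsburnSahuStraub2016, (7) (the range k ≤ n/3)] -/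
theorem summand_eq_zero_of_lt {n k : ℕ} (hn : 1 ≤ n) (hk : n < 3 * k) :
    n.choose k * (2 * k).choose k * (2 * (n - k)).choose (n - k) *
      ((2 * n - 3 * k - 1).choose n + (2 * n - 3 * k).choose n) = 0 := by
  rw [Nat.choose_eq_zero_of_lt (by omega : 2 * n - 3 * k - 1 < n), Nat.choose_eq_zero_of_lt (by omega : 2 * n - 3 * k < n)]
  simp

/-- **The free part**: «for integers `k` such that `p ∤ k`, `𝒟(mp^r, k) ≡ 0 (mod p^{2r})`. This is an immediate
consequence of the fact that `𝒟(n,k)` is divisible by `C(n,k)²`» — here as `p^{2 v_p(n)} ∣ 𝒟(n,k)` for `p ∤ k`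
(super-Catalan integrality gives `C(n,k)² ∣ C(n,k)C(2k,k)C(2(n−k),n−k)`, and `p^{v_p(n)} ∣ C(n,k)`).
[cite: OsburnSahuStraub2016, §2 (proof of Theorem 1.3, last step)] -/
theorem pow_dvd_summand_of_not_dvd (p : ℕ) [hp : Fact p.Prime] {n k : ℕ} (hk : ¬ p ∣ k) :
    (p : ℤ) ^ (2 * padicValNat p n) ∣
      (-1 : ℤ) ^ k * ((n.choose k * (2 * k).choose k * (2 * (n - k)).choose (n - k) *
        ((2 * n - 3 * k - 1).choose n + (2 * n - 3 * k).choose n) : ℕ) : ℤ) := by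
  refine Dvd.dvd.mul_left ?_ _
  rcases Nat.lt_or_ge n k with hkn | hkn
  · rw [Nat.choose_eq_zero_of_lt hkn]; simp
  have hk1 : 1 ≤ k := Nat.one_le_iff_ne_zero.mpr (fun h => hk (h ▸ dvd_zero p))
  have hv : padicValNat p n ≤ padicValNat p (n.choose k) := by
    have h := padicValNat_le_choose_add (p := p) hk1 hkn
    rw [padicValNat.eq_zero_of_not_dvd hk] at h
    omega
  have h1 : p ^ padicValNat p n ∣ n.choose k := (pow_dvd_pow p hv).trans pow_padicValNat_dvd
  have h2 : (p ^ padicValNat p n) ^ 2 ∣ n.choose k * ((2 * k).choose k * (2 * (n - k)).choose (n - k)) := by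
    rw [sq]
    exact mul_dvd_mul h1 (h1.trans (choose_dvd_centralBinom_mul hkn))
  have h3 : p ^ (2 * padicValNat p n) ∣ n.choose k * (2 * k).choose k * (2 * (n - k)).choose (n - k) *
      ((2 * n - 3 * k - 1).choose n + (2 * n - 3 * k).choose n) := by
    rw [mul_comm 2, pow_mul, mul_assoc (n.choose k)]
    exact h2.mul_right _
  exact_mod_cast Int.natCast_dvd_natCast.mpr h3

/-! ### §2. Signs -/

/-- `(−1)^a = (−1)^b` when `a ≡ b (mod 2)`. [folklore] -/
private theorem neg_one_pow_eq_of_iff {a b : ℕ} (h : Even a ↔ Even b) : (-1 : ℤ) ^ a = (-1) ^ b := by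
  rcases Nat.even_or_odd a with ha | ha
  · rw [ha.neg_one_pow, (h.mp ha).neg_one_pow]
  · have hb : Odd b := Nat.not_even_iff_odd.mp (fun hb => (Nat.not_even_iff_odd.mpr ha) (h.mpr hb))
    rw [ha.neg_one_pow, hb.neg_one_pow]

/-- **The five signs cancel**: `(−1)^{kp} · ε₁ε₂ε₃ε₄ = (−1)^k`, where `ε_i` are the signs of (41) for the pairs `(n,k)`,
`(2k,k)`, `(2(n−k),n−k)`, `(2n−3k,n)` (`ε = −1` iff `p = 2`, top even, bottom odd); for odd `p` all `ε_i = 1` and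
`kp ≡ k`, for `p = 2` this is the parity table of the printed «going through the above computations reveals that
`λ ≡ 1`». [cite: OsburnSahuStraub2016, §2 (proof of Theorem 1.3, the case p = 2)] -/
theorem sign_cancel (p : ℕ) [hp : Fact p.Prime] {n k : ℕ} (hk3 : 3 * k ≤ n) :
    (-1 : ℤ) ^ (k * p) *
      ((if p = 2 ∧ Even n ∧ ¬ Even k then (-1 : ℤ) else 1) * (if p = 2 ∧ Even (2 * k) ∧ ¬ Even k then (-1 : ℤ) else 1) *
        (if p = 2 ∧ Even (2 * (n - k)) ∧ ¬ Even (n - k) then (-1 : ℤ) else 1) *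
        (if p = 2 ∧ Even (2 * n - 3 * k) ∧ ¬ Even n then (-1 : ℤ) else 1)) = (-1) ^ k := by
  have hp' := hp.out
  have hkn : k ≤ n := by omega
  by_cases hp2 : p = 2
  · subst hp2
    have hsq : (-1 : ℤ) ^ (k * 2) = 1 := by rw [mul_comm, pow_mul, neg_one_sq, one_pow]
    rw [hsq, one_mul]
    simp only [true_and]
    have e2k : Even (2 * k) := even_two_mul k
    have e2nk : Even (2 * (n - k)) := even_two_mul _
    have h3 : ¬ Even 3 := by decide
    have hM : Even (2 * n - 3 * k) ↔ Even k := by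
      rw [Nat.even_sub (by omega : 3 * k ≤ 2 * n)]
      simp only [even_two_mul, true_iff, Nat.even_mul, h3, false_or]
    rcases Nat.even_or_odd n with hn | hn <;> rcases Nat.even_or_odd k with hk | hk
    · have hnk : Even (n - k) := (Nat.even_sub hkn).mpr (iff_of_true hn hk)
      rw [if_neg (fun h => h.2 hk), if_neg (fun h => h.2 hk), if_neg (fun h => h.2 hnk), if_neg (fun h => h.2 hn),
        hk.neg_one_pow]; norm_num
    · have hnk : Odd (n - k) := Nat.Even.sub_odd hkn hn hk
      have hk' := Nat.not_even_iff_odd.mpr hk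
      rw [if_pos ⟨hn, hk'⟩, if_pos ⟨e2k, hk'⟩, if_pos ⟨e2nk, Nat.not_even_iff_odd.mpr hnk⟩, if_neg (fun h => h.2 hn),
        hk.neg_one_pow]; norm_num
    · have hnk : Odd (n - k) := Nat.Odd.sub_even hkn hn hk
      have hn' := Nat.not_even_iff_odd.mpr hn
      rw [if_neg (fun h => h.2 hk), if_neg (fun h => h.2 hk), if_pos ⟨e2nk, Nat.not_even_iff_odd.mpr hnk⟩,
        if_pos ⟨hM.mpr hk, hn'⟩, hk.neg_one_pow]; norm_num
    · have hnk : Even (n - k) := Nat.Odd.sub_odd hn hk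
      have hn' := Nat.not_even_iff_odd.mpr hn
      have hk' := Nat.not_even_iff_odd.mpr hk
      rw [if_neg (fun h => hn' h.1), if_pos ⟨e2k, hk'⟩, if_neg (fun h => h.2 hnk), if_neg (fun h => hk' (hM.mp h.1)),
        hk.neg_one_pow]; norm_num
  · rw [if_neg (fun h => hp2 h.1), if_neg (fun h => hp2 h.1), if_neg (fun h => hp2 h.1), if_neg (fun h => hp2 h.1)]
    have hodd : Odd p := hp'.odd_of_ne_two hp2
    rw [neg_one_pow_eq_of_iff (a := k * p) (b := k) (by
      rw [Nat.even_mul]; exact ⟨fun h => h.elim id (fun h => absurd h (Nat.not_even_iff_odd.mpr hodd)), Or.inl⟩)]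
    ring

/-! ### §3. Exponent bookkeeping -/

/-- Exponent bookkeeping, odd `p` (`e = 2`): the common modulus `m = 2v(n)+2−2(v(n)−v(k))⁺` is below each of the four
moduli of (41). [cite: OsburnSahuStraub2016, §2 (proof of Theorem 1.3, exponents for p ≥ 3)] -/
theorem bookkeeping_odd {α β γ v2K v2NK v3K δ1 δ2 vC : ℕ} (hF1 : min α β ≤ γ) (hF3 : γ ≤ v2NK)
    (hF4a : β ≤ v3K) (hF6 : α ≤ vC + β) :
    2 * α + 2 - 2 * (α - β) ≤ 2 + α + β + γ ∧ 2 * α + 2 - 2 * (α - β) ≤ 2 + v2K + β + β ∧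
      2 * α + 2 - 2 * (α - β) ≤ 2 + v2NK + γ + γ ∧
      (min α v3K ≤ δ2 → 2 * α + 2 - 2 * (α - β) ≤ 2 + δ1 + α + δ2) ∧
      2 * α + 2 ≤ 2 * α + 2 - 2 * (α - β) + 2 * vC := by
  refine ⟨by omega, by omega, by omega, fun h => by omega, by omega⟩

/-- Exponent bookkeeping, `p = 2` (`e = 1`, with `v₂(2x) = 1 + v₂(x)` and the parity facts for `v₂(n) = v₂(k) = 0`).
[cite: OsburnSahuStraub2016, §2 (proof of Theorem 1.3, exponents for p = 2)] -/
theorem bookkeeping_two {α β γ v2K v2NK v2N v3K δ1 δ2 vC : ℕ} (hF1 : min α β ≤ γ) (hF4a : β ≤ v3K)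
    (hF4 : min v2N v3K ≤ δ1) (hF6 : α ≤ vC + β) (g1 : v2K = 1 + β) (g2 : v2NK = 1 + γ) (g3 : v2N = 1 + α)
    (g4 : α = 0 → β = 0 → 1 ≤ γ) :
    2 * α + 2 - 2 * (α - β) ≤ 1 + α + β + γ ∧ 2 * α + 2 - 2 * (α - β) ≤ 1 + v2K + β + β ∧
      2 * α + 2 - 2 * (α - β) ≤ 1 + v2NK + γ + γ ∧
      (min α v3K ≤ δ2 → (α = 0 → β = 0 → 1 ≤ δ2) → 2 * α + 2 - 2 * (α - β) ≤ 1 + δ1 + α + δ2) ∧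
      2 * α + 2 ≤ 2 * α + 2 - 2 * (α - β) + 2 * vC := by
  refine ⟨by omega, by omega, by omega, fun h h' => by omega, by omega⟩

/-! ### §4. The summand congruence -/

/-- **`𝒟(np, kp) ≡ 𝒟(n, k) (mod p^{2 v_p(n) + 2})`** for every prime `p`, `n ≥ 1`, `0 ≤ k ≤ n` — the termwise congruence of
the printed proof («a direct application of Lemma [Jacobsthal] shows … `≡ 1 (mod p^{r+2min(r,s)})` … Proceeding as in the
proof of Lemma 2.4, we therefore obtain `𝒟(mp^r, kp^s) ≡ 𝒟(mp^{r−1}, kp^{s−1})`», there modulo `p^{3r}` for `p ≥ 5`; with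
the weak Jacobsthal laws at `p = 3` and `p = 2` the SAME bookkeeping yields the modulus `p^{2r}` that Theorem 1.3 needs,
uniformly in `p`). Cases: `n < 3k` (both sides vanish); `k = 0` (two ratios for `C(2n,n)`); `1 ≤ k`, `3k ≤ n` (four
ratios, the fourth trivial when `n = 3k`). [cite: OsburnSahuStraub2016, §2 (proof of Theorem 1.3, eq. for 𝒟(mp^r, kp^s))] -/
theorem pow_dvd_summand_mul_prime_sub (p : ℕ) [hp : Fact p.Prime] {N K : ℕ} (hN : 1 ≤ N) (hKN : K ≤ N) :
    (p : ℤ) ^ (2 * padicValNat p N + 2) ∣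
      (-1 : ℤ) ^ (K * p) * (((N * p).choose (K * p) * (2 * (K * p)).choose (K * p) *
          (2 * (N * p - K * p)).choose (N * p - K * p) *
          ((2 * (N * p) - 3 * (K * p) - 1).choose (N * p) + (2 * (N * p) - 3 * (K * p)).choose (N * p)) : ℕ) : ℤ) -
      (-1 : ℤ) ^ K * ((N.choose K * (2 * K).choose K * (2 * (N - K)).choose (N - K) *
          ((2 * N - 3 * K - 1).choose N + (2 * N - 3 * K).choose N) : ℕ) : ℤ) := by
  have hp' := hp.out
  have hp1 : 1 ≤ p := hp'.one_lt.le
  have hNp : 1 ≤ N * p := Nat.one_le_iff_ne_zero.mpr (Nat.mul_ne_zero (by omega) hp'.ne_zero)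
  -- Case 1: `n < 3k`, both summands vanish
  rcases Nat.lt_or_ge N (3 * K) with h3 | h3
  · have h3p : N * p < 3 * (K * p) := by
      rw [show 3 * (K * p) = 3 * K * p by ring]
      exact (Nat.mul_lt_mul_right hp'.pos).mpr h3
    rw [summand_eq_zero_of_lt hN h3, summand_eq_zero_of_lt hNp h3p]
    simp
  -- the `p`-side arguments as multiples of `p`
  have r2 : 2 * (K * p) = (2 * K) * p := by ring
  have r3a : N * p - K * p = (N - K) * p := (Nat.sub_mul N K p).symm
  have r3 : 2 * ((N - K) * p) = (2 * (N - K)) * p := by ring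
  have r4 : 2 * (N * p) - 3 * (K * p) = (2 * N - 3 * K) * p := by rw [Nat.sub_mul, ← mul_assoc, ← mul_assoc]
  rw [r2, r3a, r3, r4]
  -- the common modulus and the valuation bookkeeping
  set e : ℕ := (if p = 2 then 1 else 2) with he
  set α := padicValNat p N with hα
  set β := padicValNat p K with hβ
  have heα : 2 ≤ e + padicValNat p (2 * N) ∧ α ≤ padicValNat p (2 * N) := by
    have h1 : α ≤ padicValNat p (2 * N) :=
      (padicValNat_dvd_iff_le (by omega : 2 * N ≠ 0)).mp ((pow_padicValNat_dvd (p := p) (n := N)).mul_left 2)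
    refine ⟨?_, h1⟩
    by_cases hp2 : p = 2
    · have : padicValNat p (2 * N) = 1 + α := by
        rw [padicValNat.mul (by omega) (by omega), hα]
        congr 1
        subst hp2; simp
      rw [he, if_pos hp2]; omega
    · rw [he, if_neg hp2]; omega
  -- Case 2: `k = 0`
  rcases Nat.eq_zero_or_pos K with hK0 | hK1
  · subst hK0
    simp only [Nat.choose_zero_right, mul_zero, zero_mul, Nat.choose_self, Nat.sub_zero, pow_zero, one_mul, mul_one]
    -- two copies of the ratio for `C(2n, n)`
    have hNM : N ≤ 2 * N := by omega
    have R3 := exists_ratio_prime p (a := 2 * N) (b := N) hNM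
    have R4 := exists_ratio_prime_absorbed p (M := 2 * N) (N := N) hNM (by omega)
    rw [show 2 * N - N = N by omega] at R3 R4
    have hm : 2 * α + 2 ≤ e + padicValNat p (2 * N) + α + α := by omega
    have R := ratio_mul hp' (ratio_mono hm R3) (ratio_mono hm R4)
    have hfin := pow_dvd_sub_of_ratio hp' (v := 0) R (by simp)
    rw [add_zero] at hfin
    have hεsq : (if p = 2 ∧ Even (2 * N) ∧ ¬ Even N then (-1 : ℤ) else 1) *
        (if p = 2 ∧ Even (2 * N) ∧ ¬ Even N then (-1 : ℤ) else 1) = 1 := by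
      split_ifs <;> norm_num
    rw [hεsq, one_mul] at hfin
    push_cast at hfin ⊢
    exact hfin
  -- Case 3: `1 ≤ k`, `3k ≤ n`
  have hKN' : K < N := by omega
  have hNK0 : N - K ≠ 0 := by omega
  have hM1 : 1 ≤ 2 * N - 3 * K := by omega
  have hNM : N ≤ 2 * N - 3 * K := by omega
  -- the four unit ratios, raw
  have R1raw := exists_ratio_prime p hKN
  have R2raw := exists_ratio_prime p (a := 2 * K) (b := K) (by omega)
  rw [show 2 * K - K = K by omega] at R2raw
  have R3raw := exists_ratio_prime p (a := 2 * (N - K)) (b := N - K) (by omega)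
  rw [show 2 * (N - K) - (N - K) = N - K by omega] at R3raw
  have R4raw := exists_ratio_prime_absorbed p hNM hM1
  rw [show 2 * N - 3 * K - N = N - 3 * K by omega] at R4raw
  rw [← hα, ← hβ, ← he] at R1raw
  rw [← hβ, ← he] at R2raw
  rw [← he] at R3raw
  rw [← hα, ← he] at R4raw
  -- valuation facts
  have F1 : min α β ≤ padicValNat p (N - K) := min_padicValNat_le_sub (p := p) hKN'
  have F2 : β ≤ padicValNat p (2 * K) :=
    (padicValNat_dvd_iff_le (by omega : 2 * K ≠ 0)).mp ((pow_padicValNat_dvd (p := p) (n := K)).mul_left 2)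
  have F3 : padicValNat p (N - K) ≤ padicValNat p (2 * (N - K)) :=
    (padicValNat_dvd_iff_le (by omega : 2 * (N - K) ≠ 0)).mp ((pow_padicValNat_dvd (p := p) (n := N - K)).mul_left 2)
  have F4a : β ≤ padicValNat p (3 * K) :=
    (padicValNat_dvd_iff_le (by omega : 3 * K ≠ 0)).mp ((pow_padicValNat_dvd (p := p) (n := K)).mul_left 3)
  have F4 : min (padicValNat p (2 * N)) (padicValNat p (3 * K)) ≤ padicValNat p (2 * N - 3 * K) :=
    min_padicValNat_le_sub (p := p) (by omega : 3 * K < 2 * N)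
  have F5 : 3 * K < N → min α (padicValNat p (3 * K)) ≤ padicValNat p (N - 3 * K) := fun h =>
    min_padicValNat_le_sub (p := p) h
  have F6 : α ≤ padicValNat p (N.choose K) + β := padicValNat_le_choose_add (p := p) hK1 hKN
  -- the extra facts at `p = 2`
  have G2 : p = 2 → padicValNat p (2 * K) = 1 + β ∧ padicValNat p (2 * (N - K)) = 1 + padicValNat p (N - K) ∧
      padicValNat p (2 * N) = 1 + α := by
    intro hp2
    have h2 : padicValNat p 2 = 1 := by subst hp2; simp
    refine ⟨?_, ?_, ?_⟩
    · rw [padicValNat.mul (by omega) (by omega), h2]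
    · rw [padicValNat.mul (by omega) hNK0, h2]
    · rw [padicValNat.mul (by omega) (by omega), h2]
  have G3 : p = 2 → α = 0 → β = 0 → 1 ≤ padicValNat p (N - K) ∧ (3 * K < N → 1 ≤ padicValNat p (N - 3 * K)) := by
    intro hp2 hα0 hβ0
    subst hp2
    have hN2 : ¬ 2 ∣ N := by
      have h0 : padicValNat 2 N = 0 := by omega
      rcases padicValNat.eq_zero_iff.mp h0 with h | h | h
      · norm_num at h
      · omega
      · exact h
    have hK2 : ¬ 2 ∣ K := by
      have h0 : padicValNat 2 K = 0 := by omega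
      rcases padicValNat.eq_zero_iff.mp h0 with h | h | h
      · norm_num at h
      · omega
      · exact h
    have hNo : Odd N := Nat.odd_iff.mpr (Nat.two_dvd_ne_zero.mp hN2)
    have hKo : Odd K := Nat.odd_iff.mpr (Nat.two_dvd_ne_zero.mp hK2)
    refine ⟨?_, fun h3' => ?_⟩
    · have hev : 2 ∣ N - K := (Nat.Odd.sub_odd hNo hKo).two_dvd
      exact one_le_padicValNat_of_dvd (by omega) hev
    · have hev : 2 ∣ N - 3 * K := (Nat.Odd.sub_odd hNo (Odd.mul (by decide) hKo)).two_dvd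
      exact one_le_padicValNat_of_dvd (by omega) hev
  -- name every valuation (opaque atoms for `omega`)
  set γ := padicValNat p (N - K) with hγ
  set vC := padicValNat p (N.choose K) with hvC
  set v2K := padicValNat p (2 * K) with hv2K
  set v2NK := padicValNat p (2 * (N - K)) with hv2NK
  set v2N := padicValNat p (2 * N) with hv2N
  set v3K := padicValNat p (3 * K) with hv3K
  set δ1 := padicValNat p (2 * N - 3 * K) with hδ1
  set δ2 := padicValNat p (N - 3 * K) with hδ2
  set m : ℕ := 2 * α + 2 - 2 * (α - β) with hm
  have he' : (p = 2 → e = 1) ∧ (¬ p = 2 → e = 2) :=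
    ⟨fun h => by rw [he, if_pos h], fun h => by rw [he, if_neg h]⟩
  clear_value e α β γ vC v2K v2NK v2N v3K δ1 δ2 m
  -- the common modulus `m`
  obtain ⟨i1, i2, i3, i4, hle⟩ : m ≤ e + α + β + γ ∧ m ≤ e + v2K + β + β ∧ m ≤ e + v2NK + γ + γ ∧
      (3 * K < N → m ≤ e + δ1 + α + δ2) ∧ 2 * α + 2 ≤ m + 2 * vC := by
    by_cases hp2 : p = 2
    · obtain ⟨g1, g2, g3⟩ := G2 hp2
      have g4 := G3 hp2
      rw [he'.1 hp2, hm]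
      obtain ⟨b1, b2, b3, b4, b5⟩ := bookkeeping_two F1 F4a F4 F6 g1 g2 g3 (fun h1 h2 => (g4 h1 h2).1)
      exact ⟨b1, b2, b3, fun h3' => b4 (F5 h3') (fun h1 h2 => (g4 h1 h2).2 h3'), b5⟩
    · rw [he'.2 hp2, hm]
      obtain ⟨b1, b2, b3, b4, b5⟩ := bookkeeping_odd (v2K := v2K) (δ1 := δ1) F1 F3 F4a F6
      exact ⟨b1, b2, b3, fun h3' => b4 (F5 h3'), b5⟩
  -- the four unit ratios at the common modulus
  have R1 := ratio_mono i1 R1raw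
  have R2 := ratio_mono i2 R2raw
  have R3 := ratio_mono i3 R3raw
  have R4 : ∃ x y : ℕ, ¬ p ∣ y ∧
      (y : ℤ) * ((((2 * N - 3 * K) * p - 1).choose (N * p) + ((2 * N - 3 * K) * p).choose (N * p) : ℕ) : ℤ) =
        x * ((((2 * N - 3 * K) - 1).choose N + (2 * N - 3 * K).choose N : ℕ) : ℤ) ∧
      (p : ℤ) ^ m ∣ (x : ℤ) - (if p = 2 ∧ Even (2 * N - 3 * K) ∧ ¬ Even N then -1 else 1) * y := by
    by_cases h3' : 3 * K < N
    · exact ratio_mono (i4 h3') R4raw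
    · have h3e : 3 * K = N := le_antisymm h3 (not_lt.mp h3')
      have hM : 2 * N - 3 * K = N := by rw [h3e, two_mul, Nat.add_sub_cancel]
      have c1 : (N * p - 1).choose (N * p) = 0 := Nat.choose_eq_zero_of_lt (Nat.sub_lt hNp Nat.one_pos)
      have c2 : (N - 1).choose N = 0 := Nat.choose_eq_zero_of_lt (Nat.sub_lt hN Nat.one_pos)
      have hc : ¬ (p = 2 ∧ Even N ∧ ¬ Even N) := fun h => h.2.2 h.2.1
      rw [hM]
      simp only [c1, c2, Nat.choose_self, zero_add, if_neg hc]
      exact ratio_refl p hp' m _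
  have R := ratio_mul hp' (ratio_mul hp' (ratio_mul hp' R1 R2) R3) R4
  -- `p^{2 v_p(C(n,k))} ∣ 𝒟(n,k)` without its sign
  have hv : (p : ℤ) ^ (2 * vC) ∣ ((N.choose K : ℕ) : ℤ) * (((2 * K).choose K : ℕ) : ℤ) *
      (((2 * (N - K)).choose (N - K) : ℕ) : ℤ) * ((((2 * N - 3 * K) - 1).choose N + (2 * N - 3 * K).choose N : ℕ) : ℤ) := by
    have h1 : p ^ vC ∣ N.choose K := by rw [hvC]; exact pow_padicValNat_dvd
    have h2 : (p ^ vC) ^ 2 ∣ N.choose K * ((2 * K).choose K * (2 * (N - K)).choose (N - K)) := by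
      rw [sq]; exact mul_dvd_mul h1 (h1.trans (choose_dvd_centralBinom_mul hKN))
    have h3 : p ^ (2 * vC) ∣ N.choose K * (2 * K).choose K * (2 * (N - K)).choose (N - K) *
        ((2 * N - 3 * K - 1).choose N + (2 * N - 3 * K).choose N) := by
      rw [mul_comm 2, pow_mul, mul_assoc (N.choose K)]
      exact h2.mul_right _
    have := Int.natCast_dvd_natCast.mpr h3
    push_cast at this
    exact this
  have hfin := pow_dvd_sub_of_ratio hp' R hv
  -- signs
  have hsign := sign_cancel p h3
  refine (pow_dvd_pow (p : ℤ) hle).trans ?_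
  push_cast
  rw [← hsign]
  rw [show ∀ (s ε A B : ℤ), s * A - s * ε * B = s * (A - ε * B) from fun s ε A B => by ring]
  exact hfin.mul_left _

end Literature.Combinatorics.Enumerative.SporadicS18Proofs
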